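import Summits.QuantumFields.GaugeBoot.WilsonLoopLimitHankelDiff
import Summits.QuantumFields.GaugeBoot.WilsonLoopLimitMinorTransfer
import Summits.QuantumFields.GaugeBoot.WilsonLoopLowerBounds

/-!
# Gauge-boot: the difference-Hankel (HD) transfer for `W̄(R × T)` at infinite-volume limit points (zero-solve, kernel form)

Cell `pub-gaugeboot` (HOME `run/shared/lean/pub/pub-gaugeboot/`), numerics seat `pub-gaugeboot-num1` (gen 19).
Lane SKETCH offered to the lead / the Lean seats: the kernel form of the HD-D0 / HD-D1 ZERO-SOLVE CLOSURE RULE of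
`HOME/pub-gaugeboot-num1/HANDOFF.md` GEN-13 (i)/(ii) (the parked `n1_klim6` 0.3 rule), companion of the minor transfer
`WilsonLoopLimitMinorTransfer.lean` (p318367). At every infinite-volume limit point `μ` of the `SU(N)` torus Wilson
states along EVEN tori (coupling `β/N ≥ 0`), writing `f t := ∫ W̄(t × m) dμ` for the rectangles of the `(0, j)` plane:

* `f 0 = 1` (`wilsonLoop_integral_limit_height_zero`, `N ≥ 1`; limit of the torus identity `⟨W_{0×m}⟩ = 1`);
* the DIFFERENCE sequence `g t := f t − f (t+1)` has all its `2 × 2` Hankel minors: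
  `(f (t+1) − f (t+2))² ≤ (f t − f (t+1)) · (f (t+2) − f (t+3))` for every `t`
  (`wilsonLoop_integral_limit_diff_sq_le_mul`; even `t`: the SITE difference-Hankel block HD-D0 of
  `Hankel.wilsonLoop_integral_limit_hankelDiff_site` on `S = {t/2, t/2 + 1}`; odd `t`: the LINK block HD-D1,
  `Hankel.wilsonLoop_integral_limit_hankelDiff_link`; block ⇒ minor by the discriminant, `sq_le_mul_of_forall_quadratic_nonneg`);
* hence the TRANSFER (`wilsonLoop_integral_limit_le_of_bounds_hankelDiff`, pure arithmetic `le_of_diff_sq_le_mul`): an upper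
  bound `B₀` on `f t`, a lower bound `A₁` on `f (t+1)` and an upper bound `B₂` on `f (t+2)` with `B₂ ≤ A₁ < B₀` give
  `f (t+3) ≤ c` for every `c` with `(B₀ − A₁)(B₂ − c) ≤ (A₁ − B₂)²`, i.e. `f (t+3) ≤ B₂ − (A₁ − B₂)²/(B₀ − A₁)`;
  with certified torus windows (shape (A), `Targets`) as the sources: `wilsonLoop_integral_limit_le_of_windows_hankelDiff`
  (three windows, any `t`) and `wilsonLoop_integral_limit_three_le_of_windows_hankelDiff` (`t = 0`: the plaquette-type window
  on `W̄(1 × m)` and an upper window on `W̄(2 × m)` bound `∫ W̄(3 × m) dμ`, using `f 0 ≤ 1`);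
* a mixed minor transfer `wilsonLoop_integral_limit_le_of_window_bound_minor` (one torus window and one limit-level bound
  in `wilsonLoop_integral_limit_sq_le_mul`), so that a derived bound can be chained into the link minor;
* the instances for SU(2), `D = 3` at STRONG coupling, where the rule bites (`B₂ = U₁₂ ≤ u_L = A₁`), taking AS HYPOTHESES
  the referee-signed torus windows of `certs/index.jsonl` (certsdp dual certificates verified by the readers A/B/O, NOT
  kernel theorems): `β_std = 1/2`: `∫ W̄(1 × 3) dμ ≤ 156575506 / 10¹⁰` (`w1x3_integral_limit_le_of_windows_b1o2`; sources
  `N1-glyz-c3-b1o2-plaquette-lower` ≥ 0.1236342843, `N1-kz-L2-rp-b1o2-w1x2-upper` ≤ 0.0264375344; the torus-uniform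
  certificate `N1-kz-L2-rp-b1o2-w1x3-upper` reads ≤ 0.0411029889, the monotone transfer ≤ 0.0264375344) and then
  `∫ W̄(2 × 2) dμ ≤ 203456883 / 10¹⁰` (`w2x2_integral_limit_le_of_windows_b1o2`; torus certificate ≤ 0.3538644908, plain
  minor transfer ≤ 0.0329645519); `β_std = 1`: `∫ W̄(1 × 3) dμ ≤ 869905220 / 10¹⁰` (`…_b1`; torus ≤ 0.1110458441, monotone
  ≤ 0.1092807573) and `∫ W̄(2 × 2) dμ ≤ 975007186 / 10¹⁰` (torus ≤ 0.4534441531, plain minor ≤ 0.1101597655).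
  The constants are the outward 10-decimal ceilings of `B₂ − (A₁ − B₂)²/(1 − A₁)` and of `√(B₂ c)`; `norm_num` checks the
  two arithmetic side conditions. For `β_std ≥ 2` the transfer still applies (`U₁₂ ≤ u_L` at every coupling of record)
  but is WEAKER than the torus-uniform `W̄(1 × 3)` certificate of the same coupling (no gain; e.g. `β_std = 2`: 0.3387 vs 0.2874).

LIMIT POINTS ONLY: antitonicity in the height and the all-order Hankel families behind Lemma HD are false / unavailable on a
fixed torus (wrap-around; `LIMIT-SOUNDNESS.md` §S.3). DERIVED ZERO-SOLVE READINGS: nothing here is a certificate, no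
certificate and no CERTIFIED row changes; the instances are kernel-checked IMPLICATIONS from certificates taken as hypotheses.

HONEST FRAMING (page 1 of every file of this cell): certified bounds on lattice expectations at STATED coupling, gauge
group, dimension and torus size; class LIMIT = limit points of even-side torus states along `L → ∞`, NOT a finite-torus
bound; not a mass gap, not a continuum limit, no uniqueness of the limit claimed, never 'string tension'; NOT
Yang–Mills-summit-bearing (barriers `FixedCouplingUltralocality`, `PerturbativeInvisibility`).
-/

noncomputable section

open MeasureTheory Filter Topology
open Literature.MathematicalPhysics.QuantumFieldTheory
open Literature.MathematicalPhysics.QuantumLattice (LGConfig IsInfiniteVolumeLimitAlong wilsonLoopObs rectWalk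
  normalisedCharacter)
open Literature.RepresentationTheory.CompactGroups

namespace Summit.QuantumFields.GaugeBoot

/-! ## Two torus-level window conversions (vocabulary of `Targets`) -/

/-- A certified `W(R×T)` window is a certified `W(T×R)` window (`wilsonLoopExpectation_comm`, `D ≥ 2`). [folklore] -/
theorem WilsonLoopWindow.symm {N D L₀ : ℕ} {β : ℝ} {R T : ℕ} {a b : ℝ} (hD : 2 ≤ D)
    (h : WilsonLoopWindow N D L₀ β R T a b) : WilsonLoopWindow N D L₀ β T R a b := by
  intro L _ hL hL₀
  rw [← wilsonLoopExpectation_comm hD L β R T]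
  exact h L hL hL₀

/-- A certified plaquette window is a certified `W(1×1)` window (`wilsonLoopExpectation_one_one`). [folklore] -/
theorem PlaquetteWindow.wilsonLoopWindow_one_one {N D L₀ : ℕ} {β a b : ℝ}
    (h : PlaquetteWindow N D L₀ β a b) : WilsonLoopWindow N D L₀ β 1 1 a b := by
  intro L _ hL hL₀
  rw [wilsonLoopExpectation_one_one]
  exact h L hL hL₀

/-! ## Pure arithmetic: a two-point PSD block gives its minor; the HD transfer inequality -/

/-- If the `2 × 2` block `[g(p+q)]_{p,q ∈ {a,b}}` (`a ≠ b`) is positive semidefinite as a quadratic form, then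
`g(a+b)² ≤ g(2a) · g(2b)` (discriminant). [folklore] -/
theorem sq_le_mul_of_psd_pair (g : ℕ → ℝ) {a b : ℕ} (hab : a ≠ b)
    (hp : ∀ c : ℕ → ℝ, 0 ≤ ∑ p ∈ ({a, b} : Finset ℕ), ∑ q ∈ ({a, b} : Finset ℕ), c p * c q * g (p + q)) :
    g (a + b) ^ 2 ≤ g (a + a) * g (b + b) := by
  refine sq_le_mul_of_forall_quadratic_nonneg fun x => ?_
  have h := hp (fun n => if n = a then x else 1)
  simp only [Finset.sum_pair hab, if_true, if_neg hab.symm, Nat.add_comm b a] at h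
  linarith [h]

/-- **The HD transfer inequality (pure real arithmetic).** If `(x₁ − x₂)² ≤ (x₀ − x₁)(x₂ − x₃)`, `x₃ ≤ x₂`,
`x₀ ≤ B₀`, `A₁ ≤ x₁`, `x₂ ≤ B₂` with `B₂ ≤ A₁ < B₀`, then `x₃ ≤ c` for every `c` with
`(B₀ − A₁)(B₂ − c) ≤ (A₁ − B₂)²` (the weakest such `c` is `B₂ − (A₁ − B₂)²/(B₀ − A₁)`). [folklore] -/
theorem le_of_diff_sq_le_mul {x₀ x₁ x₂ x₃ B₀ A₁ B₂ c : ℝ}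
    (hmin : (x₁ - x₂) ^ 2 ≤ (x₀ - x₁) * (x₂ - x₃)) (h₃₂ : x₃ ≤ x₂)
    (h₀ : x₀ ≤ B₀) (h₁ : A₁ ≤ x₁) (h₂ : x₂ ≤ B₂)
    (hδ : B₂ ≤ A₁) (hP : A₁ < B₀) (hc : (B₀ - A₁) * (B₂ - c) ≤ (A₁ - B₂) ^ 2) : x₃ ≤ c := by
  by_contra hlt
  rw [not_le] at hlt
  have hBc : x₂ - x₃ < B₂ - c := by linarith
  have hr0 : 0 ≤ x₂ - x₃ := by linarith
  have hδ' : 0 ≤ A₁ - B₂ := by linarith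
  have hq : A₁ - B₂ ≤ x₁ - x₂ := by linarith
  have hP' : 0 < B₀ - A₁ := by linarith
  have hp : x₀ - x₁ ≤ B₀ - A₁ := by linarith
  rcases le_or_gt (x₀ - x₁) 0 with hp0 | hp0
  · -- degenerate: `x₀ - x₁ ≤ 0` forces `x₁ = x₂`, hence `A₁ = B₂`, contradicting `hc`
    have h1 : (x₁ - x₂) ^ 2 ≤ 0 := by nlinarith [hmin, hp0, hr0]
    have h2 : x₁ - x₂ = 0 := by nlinarith [sq_nonneg (x₁ - x₂)]
    have h3 : A₁ - B₂ = 0 := le_antisymm (by linarith) hδ'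
    have h4 : (B₀ - A₁) * (B₂ - c) ≤ 0 := by
      have h := hc
      rw [h3] at h
      simpa using h
    have h5 : 0 < (B₀ - A₁) * (B₂ - c) := mul_pos hP' (by linarith)
    linarith
  · have h1 : (x₀ - x₁) * (x₂ - x₃) < (x₀ - x₁) * (B₂ - c) := mul_lt_mul_of_pos_left hBc hp0
    have h2 : (x₀ - x₁) * (B₂ - c) ≤ (B₀ - A₁) * (B₂ - c) :=
      mul_le_mul_of_nonneg_right hp (by linarith)
    have h3 : (A₁ - B₂) ^ 2 ≤ (x₁ - x₂) ^ 2 := pow_le_pow_left₀ hδ' hq 2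
    linarith [hmin, hc]

namespace WilsonLoopLimit

variable {D N : ℕ} [NeZero D]

/-! ## The corner `∫ W̄(0 × m) dμ = 1` and the difference minors at a limit point -/

/-- **`∫ W̄(0 × m) dμ = 1`** at every infinite-volume limit point of the `SU(N)` torus Wilson states (`N ≥ 1`, any
real coupling, any subsequence of sides): the limit of the torus identity `⟨W_{0×m}⟩ = 1`
(`wilsonExpectation_wilsonLoop_height_zero`). [folklore] -/
theorem wilsonLoop_integral_limit_height_zero (hN : N ≠ 0) {β : ℝ} {Lk : ℕ → ℕ}
    {μ : Measure (LGConfig D (SU N))} (hμ : IsInfiniteVolumeLimitAlong (suRep N) (β / N) Lk μ)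
    (j : Fin D) (m : ℕ) :
    ∫ U, wilsonLoopObs (normalisedCharacter N ∘ suRep N)
        (rectWalk (0 : Literature.Probability.LatticeModels.Site D) 0 j 0 m) U ∂μ = 1 := by
  have h := tendsto_wilsonExpectation_wilsonLoop hμ j 0 m
  have e : (fun k => wilsonExpectation (suRep N) (β / N)
      (wilsonLoop (suRep N) (0 : Site D (Lk k + 1)) 0 j 0 m)) = fun _ => (1 : ℝ) :=
    funext fun k => wilsonExpectation_wilsonLoop_height_zero (suRep N) (continuous_suRep N) hN _ _ _ _ _
  rw [e] at h
  exact tendsto_nhds_unique h tendsto_const_nhds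

/-- **Difference minors at a limit point.** For a limit point `μ` of the `SU(N)` torus Wilson states along even tori at
coupling `β/N ≥ 0`, a spatial axis `j ≠ 0` and a width `m`, the sequence `f t = ∫ W̄(t × m) dμ` satisfies
`(f (t+1) − f (t+2))² ≤ (f t − f (t+1)) · (f (t+2) − f (t+3))` for every `t`: for even `t = 2a` this is the minor of
the SITE difference-Hankel block HD-D0 on `S = {a, a+1}` (`Hankel.wilsonLoop_integral_limit_hankelDiff_site`), for odd
`t = 2a+1` the minor of the LINK block HD-D1 (`Hankel.wilsonLoop_integral_limit_hankelDiff_link`). LIMIT POINTS ONLY.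
[folklore] -/
theorem wilsonLoop_integral_limit_diff_sq_le_mul {β : ℝ} (hβ : 0 ≤ β) {Lk : ℕ → ℕ} (hmono : StrictMono Lk)
    (heven : ∀ k, Even (Lk k + 1)) {μ : Measure (LGConfig D (SU N))}
    (hμ : IsInfiniteVolumeLimitAlong (suRep N) (β / N) Lk μ) {j : Fin D} (hj : j ≠ 0) (m t : ℕ) :
    (∫ U, wilsonLoopObs (normalisedCharacter N ∘ suRep N)
          (rectWalk (0 : Literature.Probability.LatticeModels.Site D) 0 j (t + 1) m) U ∂μ -
        ∫ U, wilsonLoopObs (normalisedCharacter N ∘ suRep N)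
          (rectWalk (0 : Literature.Probability.LatticeModels.Site D) 0 j (t + 2) m) U ∂μ) ^ 2 ≤
      ((∫ U, wilsonLoopObs (normalisedCharacter N ∘ suRep N)
            (rectWalk (0 : Literature.Probability.LatticeModels.Site D) 0 j t m) U ∂μ) -
          ∫ U, wilsonLoopObs (normalisedCharacter N ∘ suRep N)
            (rectWalk (0 : Literature.Probability.LatticeModels.Site D) 0 j (t + 1) m) U ∂μ) *
        ((∫ U, wilsonLoopObs (normalisedCharacter N ∘ suRep N)
            (rectWalk (0 : Literature.Probability.LatticeModels.Site D) 0 j (t + 2) m) U ∂μ) -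
          ∫ U, wilsonLoopObs (normalisedCharacter N ∘ suRep N)
            (rectWalk (0 : Literature.Probability.LatticeModels.Site D) 0 j (t + 3) m) U ∂μ) := by
  let f : ℕ → ℝ := fun t =>
    ∫ U, wilsonLoopObs (normalisedCharacter N ∘ suRep N)
      (rectWalk (0 : Literature.Probability.LatticeModels.Site D) 0 j t m) U ∂μ
  rcases Nat.even_or_odd t with ⟨a, rfl⟩ | ⟨a, rfl⟩
  · -- `t = a + a`: HD-D0 on `S = {a, a+1}` for `g n = f n - f (n+1)`
    have hp : ∀ c : ℕ → ℝ, 0 ≤ ∑ p ∈ ({a, a + 1} : Finset ℕ), ∑ q ∈ ({a, a + 1} : Finset ℕ),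
        c p * c q * (f (p + q) - f (p + q + 1)) := fun c =>
      Hankel.wilsonLoop_integral_limit_hankelDiff_site hβ hmono heven hμ hj m {a, a + 1} c
    have key := sq_le_mul_of_psd_pair (fun n => f n - f (n + 1)) (show a ≠ a + 1 by omega) hp
    have e1 : a + (a + 1) = a + a + 1 := by ring
    have e2 : a + 1 + (a + 1) = a + a + 2 := by ring
    simp only [e1, e2] at key
    exact key
  · -- `t = 2a + 1`: HD-D1 on `S = {a, a+1}` for `g n = f (n+1) - f (n+2)`
    have hq : ∀ c : ℕ → ℝ, 0 ≤ ∑ p ∈ ({a, a + 1} : Finset ℕ), ∑ q ∈ ({a, a + 1} : Finset ℕ),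
        c p * c q * (f (p + q + 1) - f (p + q + 2)) := fun c =>
      Hankel.wilsonLoop_integral_limit_hankelDiff_link hβ hmono heven hμ hj m {a, a + 1} c
    have key := sq_le_mul_of_psd_pair (fun n => f (n + 1) - f (n + 2)) (show a ≠ a + 1 by omega) hq
    have e1 : a + (a + 1) + 1 = 2 * a + 1 + 1 := by ring
    have e2 : a + (a + 1) + 2 = 2 * a + 1 + 2 := by ring
    have e3 : a + a + 1 = 2 * a + 1 := by ring
    have e4 : a + a + 2 = 2 * a + 1 + 1 := by ring
    have e5 : a + 1 + (a + 1) + 1 = 2 * a + 1 + 2 := by ring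
    have e6 : a + 1 + (a + 1) + 2 = 2 * a + 1 + 3 := by ring
    simp only [e1, e2, e3, e4, e5, e6] at key
    exact key

/-! ## The HD transfer at a limit point -/

/-- **HD transfer at a limit point (bounds form).** For a limit point `μ` of the `SU(N)` torus Wilson states along even
tori at coupling `β/N ≥ 0`, a spatial axis `j ≠ 0`, a width `m` and a height `t`: an upper bound `B₀` on
`∫ W̄(t × m) dμ`, a lower bound `A₁` on `∫ W̄((t+1) × m) dμ` and an upper bound `B₂` on `∫ W̄((t+2) × m) dμ` with
`B₂ ≤ A₁ < B₀` give `∫ W̄((t+3) × m) dμ ≤ c` for every `c` with `(B₀ − A₁)(B₂ − c) ≤ (A₁ − B₂)²`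
(difference minor `wilsonLoop_integral_limit_diff_sq_le_mul` + antitonicity `antitone_wilsonLoop_integral_limit` +
`le_of_diff_sq_le_mul`). The sources of `B₀, A₁, B₂` are arbitrary (torus windows, class-LIMIT rows, derived bounds).
LIMIT POINTS ONLY. [folklore] -/
theorem wilsonLoop_integral_limit_le_of_bounds_hankelDiff {β : ℝ} (hβ : 0 ≤ β) {Lk : ℕ → ℕ}
    (hmono : StrictMono Lk) (heven : ∀ k, Even (Lk k + 1)) {μ : Measure (LGConfig D (SU N))}
    (hμ : IsInfiniteVolumeLimitAlong (suRep N) (β / N) Lk μ) {j : Fin D} (hj : j ≠ 0) (m t : ℕ)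
    {B₀ A₁ B₂ c : ℝ}
    (h₀ : ∫ U, wilsonLoopObs (normalisedCharacter N ∘ suRep N)
        (rectWalk (0 : Literature.Probability.LatticeModels.Site D) 0 j t m) U ∂μ ≤ B₀)
    (h₁ : A₁ ≤ ∫ U, wilsonLoopObs (normalisedCharacter N ∘ suRep N)
        (rectWalk (0 : Literature.Probability.LatticeModels.Site D) 0 j (t + 1) m) U ∂μ)
    (h₂ : ∫ U, wilsonLoopObs (normalisedCharacter N ∘ suRep N)
        (rectWalk (0 : Literature.Probability.LatticeModels.Site D) 0 j (t + 2) m) U ∂μ ≤ B₂)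
    (hδ : B₂ ≤ A₁) (hP : A₁ < B₀) (hc : (B₀ - A₁) * (B₂ - c) ≤ (A₁ - B₂) ^ 2) :
    ∫ U, wilsonLoopObs (normalisedCharacter N ∘ suRep N)
        (rectWalk (0 : Literature.Probability.LatticeModels.Site D) 0 j (t + 3) m) U ∂μ ≤ c := by
  have hmin := wilsonLoop_integral_limit_diff_sq_le_mul hβ hmono heven hμ hj m t
  have hanti := (antitone_wilsonLoop_integral_limit hβ hmono heven hμ hj m).1
  have h32 : ∫ U, wilsonLoopObs (normalisedCharacter N ∘ suRep N)
        (rectWalk (0 : Literature.Probability.LatticeModels.Site D) 0 j (t + 3) m) U ∂μ ≤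
      ∫ U, wilsonLoopObs (normalisedCharacter N ∘ suRep N)
        (rectWalk (0 : Literature.Probability.LatticeModels.Site D) 0 j (t + 2) m) U ∂μ :=
    hanti (Nat.le_succ (t + 2))
  exact le_of_diff_sq_le_mul hmin h32 h₀ h₁ h₂ hδ hP hc

/-- **HD transfer from three certified torus windows.** Shape-(A) windows on `W̄(t × m)` (upper end `b₀`),
`W̄((t+1) × m)` (lower end `a₁`) and `W̄((t+2) × m)` (upper end `b₂`) with `b₂ ≤ a₁ < b₀` give
`∫ W̄((t+3) × m) dμ ≤ c` at every even-side limit point, for every `c` with `(b₀ − a₁)(b₂ − c) ≤ (a₁ − b₂)²`;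
exact arithmetic on certified endpoints, no further solve (`t = 1`, `m = 1`: the HD-D1 'line-1 rule'
`W̄(1×4) ≤ U₁₃ − (L₁₂ − U₁₃)²/(u_U − L₁₂)`). LIMIT POINTS ONLY. [folklore] -/
theorem wilsonLoop_integral_limit_le_of_windows_hankelDiff {L₀ L₁ L₂ : ℕ} {β a₀ b₀ a₁ b₁ a₂ b₂ c : ℝ}
    (hβ : 0 ≤ β) {t m : ℕ} (h₀ : WilsonLoopWindow N D L₀ β t m a₀ b₀)
    (h₁ : WilsonLoopWindow N D L₁ β (t + 1) m a₁ b₁) (h₂ : WilsonLoopWindow N D L₂ β (t + 2) m a₂ b₂)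
    (hδ : b₂ ≤ a₁) (hP : a₁ < b₀) (hc : (b₀ - a₁) * (b₂ - c) ≤ (a₁ - b₂) ^ 2)
    {Lk : ℕ → ℕ} (hmono : StrictMono Lk) (heven : ∀ k, Even (Lk k + 1))
    {μ : Measure (LGConfig D (SU N))} (hμ : IsInfiniteVolumeLimitAlong (suRep N) (β / N) Lk μ)
    {j : Fin D} (hj : j ≠ 0) :
    ∫ U, wilsonLoopObs (normalisedCharacter N ∘ suRep N)
        (rectWalk (0 : Literature.Probability.LatticeModels.Site D) 0 j (t + 3) m) U ∂μ ≤ c :=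
  wilsonLoop_integral_limit_le_of_bounds_hankelDiff hβ hmono heven hμ hj m t
    (h₀.integral_limit_mem hmono heven hμ 0 hj.symm).2 (h₁.integral_limit_mem hmono heven hμ 0 hj.symm).1
    (h₂.integral_limit_mem hmono heven hμ 0 hj.symm).2 hδ hP hc

/-- **HD-D0 transfer from two certified torus windows (`t = 0`, the rule that bites at strong coupling).** A window
on `W̄(1 × m)` with lower end `a₁ < 1` and a window on `W̄(2 × m)` with upper end `b₂ ≤ a₁` give
`∫ W̄(3 × m) dμ ≤ c` at every even-side limit point for every `c` with `(1 − a₁)(b₂ − c) ≤ (a₁ − b₂)²`, i.e.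
`∫ W̄(3 × m) dμ ≤ b₂ − (a₁ − b₂)²/(1 − a₁)` (the bound `∫ W̄(0 × m) dμ ≤ 1` replaces the third window). On the line
`m = 1` this is the scalar content of block B1 = `[[1 − u, u − W₁₂], [u − W₁₂, W₁₂ − W₁₃]] ⪰ 0` of the class-LIMIT
object (`LIMIT-SOUNDNESS.md` §P.2). LIMIT POINTS ONLY. [folklore] -/
theorem wilsonLoop_integral_limit_three_le_of_windows_hankelDiff {L₁ L₂ : ℕ} {β a₁ b₁ a₂ b₂ c : ℝ}
    (hβ : 0 ≤ β) {m : ℕ} (h₁ : WilsonLoopWindow N D L₁ β 1 m a₁ b₁)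
    (h₂ : WilsonLoopWindow N D L₂ β 2 m a₂ b₂)
    (hδ : b₂ ≤ a₁) (ha : a₁ < 1) (hc : (1 - a₁) * (b₂ - c) ≤ (a₁ - b₂) ^ 2)
    {Lk : ℕ → ℕ} (hmono : StrictMono Lk) (heven : ∀ k, Even (Lk k + 1))
    {μ : Measure (LGConfig D (SU N))} (hμ : IsInfiniteVolumeLimitAlong (suRep N) (β / N) Lk μ)
    {j : Fin D} (hj : j ≠ 0) :
    ∫ U, wilsonLoopObs (normalisedCharacter N ∘ suRep N)
        (rectWalk (0 : Literature.Probability.LatticeModels.Site D) 0 j 3 m) U ∂μ ≤ c := by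
  obtain ⟨-, h1, -⟩ := wilsonLoop_integral_limit_hankel hβ hmono heven hμ hj m
  have h₀ : ∫ U, wilsonLoopObs (normalisedCharacter N ∘ suRep N)
      (rectWalk (0 : Literature.Probability.LatticeModels.Site D) 0 j 0 m) U ∂μ ≤ 1 := h1 0
  exact wilsonLoop_integral_limit_le_of_bounds_hankelDiff hβ hmono heven hμ hj m 0 h₀
    (h₁.integral_limit_mem hmono heven hμ 0 hj.symm).1 (h₂.integral_limit_mem hmono heven hμ 0 hj.symm).2 hδ ha hc

/-- **Mixed minor transfer** (one window, one limit-level bound): if `W̄(t × m) ≤ b₁` on all even tori `≥ L₁`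
(shape (A)), `∫ W̄(s × (t+2)) dμ ≤ b₂` at the limit point, `s ≤ m`, `0 ≤ c` and `b₁ b₂ ≤ c²`, then
`∫ W̄((t+1) × m) dμ ≤ c` (`wilsonLoop_integral_limit_sq_le_mul`); the variant of
`wilsonLoop_integral_limit_le_of_windows_minor` that lets a DERIVED bound (e.g. an HD transfer) enter the link minor.
LIMIT POINTS ONLY. [folklore] -/
theorem wilsonLoop_integral_limit_le_of_window_bound_minor {L₁ : ℕ} {β a₁ b₁ b₂ c : ℝ} (hβ : 0 ≤ β)
    {t m s : ℕ} (hs : s ≤ m) (h₁ : WilsonLoopWindow N D L₁ β t m a₁ b₁)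
    {Lk : ℕ → ℕ} (hmono : StrictMono Lk) (heven : ∀ k, Even (Lk k + 1))
    {μ : Measure (LGConfig D (SU N))} (hμ : IsInfiniteVolumeLimitAlong (suRep N) (β / N) Lk μ)
    {j : Fin D} (hj : j ≠ 0)
    (h₂ : ∫ U, wilsonLoopObs (normalisedCharacter N ∘ suRep N)
        (rectWalk (0 : Literature.Probability.LatticeModels.Site D) 0 j s (t + 2)) U ∂μ ≤ b₂)
    (hc : 0 ≤ c) (hcb : b₁ * b₂ ≤ c ^ 2) :
    ∫ U, wilsonLoopObs (normalisedCharacter N ∘ suRep N)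
        (rectWalk (0 : Literature.Probability.LatticeModels.Site D) 0 j (t + 1) m) U ∂μ ≤ c := by
  have hsq := wilsonLoop_integral_limit_sq_le_mul hβ hmono heven hμ hj t m hs
  obtain ⟨h0m, -, -⟩ := wilsonLoop_integral_limit_hankel hβ hmono heven hμ hj m
  obtain ⟨h0t, -, -⟩ := wilsonLoop_integral_limit_hankel hβ hmono heven hμ hj (t + 2)
  have hb₁ := (h₁.integral_limit_mem hmono heven hμ 0 hj.symm).2
  have h0₁ : 0 ≤ ∫ U, wilsonLoopObs (normalisedCharacter N ∘ suRep N)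
      (rectWalk (0 : Literature.Probability.LatticeModels.Site D) 0 j t m) U ∂μ := h0m t
  have h0₂ : 0 ≤ ∫ U, wilsonLoopObs (normalisedCharacter N ∘ suRep N)
      (rectWalk (0 : Literature.Probability.LatticeModels.Site D) 0 j s (t + 2)) U ∂μ := h0t s
  have hprod : (∫ U, wilsonLoopObs (normalisedCharacter N ∘ suRep N)
        (rectWalk (0 : Literature.Probability.LatticeModels.Site D) 0 j t m) U ∂μ) *
      ∫ U, wilsonLoopObs (normalisedCharacter N ∘ suRep N)
        (rectWalk (0 : Literature.Probability.LatticeModels.Site D) 0 j s (t + 2)) U ∂μ ≤ b₁ * b₂ :=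
    mul_le_mul hb₁ h₂ h0₂ (h0₁.trans hb₁)
  have hX : (∫ U, wilsonLoopObs (normalisedCharacter N ∘ suRep N)
      (rectWalk (0 : Literature.Probability.LatticeModels.Site D) 0 j (t + 1) m) U ∂μ) ^ 2 ≤ c ^ 2 :=
    hsq.trans (hprod.trans hcb)
  exact (abs_le_of_sq_le_sq' hX hc).2

/-! ## Instances: SU(2), `D = 3`, strong coupling (certificates of record as hypotheses) -/

/-- **`β_std = 1/2`: `∫ W̄(1 × 3) dμ ≤ 156575506 / 10¹⁰` at every even-side limit point**, taking AS HYPOTHESES the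
referee-signed torus windows `N1-glyz-c3-b1o2-plaquette-lower` (`ū_P ≥ 149464678482863936882803 / 2^80`, every even
`L ≥ 6`; `certs/index.jsonl`) and `N1-kz-L2-rp-b1o2-w1x2-upper` (`W̄(1×2) ≤ 479415268187497607671789 / (15 · 2^80)`,
every even `L ≥ 8`) — certsdp dual certificates verified by the readers A/B/O, NOT kernel theorems. The constant is the
outward 10-decimal ceiling of `b₂ − (a₁ − b₂)²/(1 − a₁) = 0.0156575505…`; the torus-uniform certificate
`N1-kz-L2-rp-b1o2-w1x3-upper` reads `≤ 0.0411029889` and the monotone transfer `≤ 0.0264375344`. DERIVED ZERO-SOLVE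
READING, LIMIT POINTS ONLY, not a certificate. [folklore] -/
theorem w1x3_integral_limit_le_of_windows_b1o2 {L₁ L₂ : ℕ} {b₁ a₂ : ℝ}
    (hU : T1 L₁ (1 / 2) (149464678482863936882803 / 1208925819614629174706176) b₁)
    (hW : T1W L₂ (1 / 2) 1 2 a₂ (479415268187497607671789 / 18133887294219437620592640))
    {Lk : ℕ → ℕ} (hmono : StrictMono Lk) (heven : ∀ k, Even (Lk k + 1))
    {μ : Measure (LGConfig 3 (SU 2))}
    (hμ : IsInfiniteVolumeLimitAlong (suRep 2) ((1 / 2 : ℝ) / ((2 : ℕ) : ℝ)) Lk μ) {j : Fin 3} (hj : j ≠ 0) :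
    ∫ U, wilsonLoopObs (normalisedCharacter 2 ∘ suRep 2)
        (rectWalk (0 : Literature.Probability.LatticeModels.Site 3) 0 j 1 3) U ∂μ ≤ 156575506 / 10 ^ 10 := by
  rw [wilsonLoop_integral_limit_comm hμ hj 1 3]
  exact wilsonLoop_integral_limit_three_le_of_windows_hankelDiff (N := 2) (D := 3) (m := 1) (by norm_num)
    hU.wilsonLoopWindow_one_one (hW.symm (by norm_num)) (by norm_num) (by norm_num) (by norm_num)
    hmono heven hμ hj

/-- **`β_std = 1/2`: `∫ W̄(2 × 2) dμ ≤ 203456883 / 10¹⁰` at every even-side limit point** (same two certificates as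
hypotheses): the link minor `(∫ W̄(2×2))² ≤ ∫ W̄(1×2) · ∫ W̄(1×3)` with the window `≤ b₂` on `W̄(1×2)` and the HD
transfer `w1x3_integral_limit_le_of_windows_b1o2` on `W̄(1×3)`; constant = outward 10-decimal ceiling of
`√(b₂ · 156575506/10¹⁰)`. The torus-uniform certificate `N1-kz-L2-rp-b1o2-w2x2-upper` reads `≤ 0.3538644908`, the plain
minor transfer from the two torus uppers `≤ 0.0329645519`. DERIVED, LIMIT POINTS ONLY, not a certificate. [folklore] -/
theorem w2x2_integral_limit_le_of_windows_b1o2 {L₁ L₂ : ℕ} {b₁ a₂ : ℝ}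
    (hU : T1 L₁ (1 / 2) (149464678482863936882803 / 1208925819614629174706176) b₁)
    (hW : T1W L₂ (1 / 2) 1 2 a₂ (479415268187497607671789 / 18133887294219437620592640))
    {Lk : ℕ → ℕ} (hmono : StrictMono Lk) (heven : ∀ k, Even (Lk k + 1))
    {μ : Measure (LGConfig 3 (SU 2))}
    (hμ : IsInfiniteVolumeLimitAlong (suRep 2) ((1 / 2 : ℝ) / ((2 : ℕ) : ℝ)) Lk μ) {j : Fin 3} (hj : j ≠ 0) :
    ∫ U, wilsonLoopObs (normalisedCharacter 2 ∘ suRep 2)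
        (rectWalk (0 : Literature.Probability.LatticeModels.Site 3) 0 j 2 2) U ∂μ ≤ 203456883 / 10 ^ 10 :=
  wilsonLoop_integral_limit_le_of_window_bound_minor (N := 2) (D := 3) (t := 1) (m := 2) (s := 1)
    (by norm_num) (by norm_num) hW hmono heven hμ hj
    (w1x3_integral_limit_le_of_windows_b1o2 hU hW hmono heven hμ hj) (by norm_num) (by norm_num)

/-- **`β_std = 1`: `∫ W̄(1 × 3) dμ ≤ 869905220 / 10¹⁰` at every even-side limit point**, taking AS HYPOTHESES the
referee-signed torus windows `N1-glyz-c3-b1-plaquette-lower` (`ū_P ≥ 72378738384485574618679 / 2^78`, even `L ≥ 6`)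
and `N1-kz-L2-rp-b1-w1x2-upper` (`W̄(1×2) ≤ 5945054807643791267722879 / (45 · 2^80)`, even `L ≥ 8`). Constant =
outward 10-decimal ceiling of `b₂ − (a₁ − b₂)²/(1 − a₁) = 0.0869905219…`; torus-uniform certificate
`N1-kz-L2-rp-b1-w1x3-upper` `≤ 0.1110458441`, monotone transfer `≤ 0.1092807573`. DERIVED, LIMIT POINTS ONLY, not a
certificate. [folklore] -/
theorem w1x3_integral_limit_le_of_windows_b1 {L₁ L₂ : ℕ} {b₁ a₂ : ℝ}
    (hU : T1 L₁ 1 (72378738384485574618679 / 302231454903657293676544) b₁)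
    (hW : T1W L₂ 1 1 2 a₂ (5945054807643791267722879 / 54401661882658312861777920))
    {Lk : ℕ → ℕ} (hmono : StrictMono Lk) (heven : ∀ k, Even (Lk k + 1))
    {μ : Measure (LGConfig 3 (SU 2))}
    (hμ : IsInfiniteVolumeLimitAlong (suRep 2) ((1 : ℝ) / ((2 : ℕ) : ℝ)) Lk μ) {j : Fin 3} (hj : j ≠ 0) :
    ∫ U, wilsonLoopObs (normalisedCharacter 2 ∘ suRep 2)
        (rectWalk (0 : Literature.Probability.LatticeModels.Site 3) 0 j 1 3) U ∂μ ≤ 869905220 / 10 ^ 10 := by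
  rw [wilsonLoop_integral_limit_comm hμ hj 1 3]
  exact wilsonLoop_integral_limit_three_le_of_windows_hankelDiff (N := 2) (D := 3) (m := 1) (by norm_num)
    hU.wilsonLoopWindow_one_one (hW.symm (by norm_num)) (by norm_num) (by norm_num) (by norm_num)
    hmono heven hμ hj

/-- **`β_std = 1`: `∫ W̄(2 × 2) dμ ≤ 975007186 / 10¹⁰` at every even-side limit point** (same two certificates as
hypotheses; link minor + HD transfer; constant = outward 10-decimal ceiling of `√(b₂ · 869905220/10¹⁰)`). Torus-uniform
certificate `N1-kz-L2-rp-b1-w2x2-upper` `≤ 0.4534441531`, plain minor transfer `≤ 0.1101597655`. DERIVED, LIMIT POINTS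
ONLY, not a certificate. [folklore] -/
theorem w2x2_integral_limit_le_of_windows_b1 {L₁ L₂ : ℕ} {b₁ a₂ : ℝ}
    (hU : T1 L₁ 1 (72378738384485574618679 / 302231454903657293676544) b₁)
    (hW : T1W L₂ 1 1 2 a₂ (5945054807643791267722879 / 54401661882658312861777920))
    {Lk : ℕ → ℕ} (hmono : StrictMono Lk) (heven : ∀ k, Even (Lk k + 1))
    {μ : Measure (LGConfig 3 (SU 2))}
    (hμ : IsInfiniteVolumeLimitAlong (suRep 2) ((1 : ℝ) / ((2 : ℕ) : ℝ)) Lk μ) {j : Fin 3} (hj : j ≠ 0) :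
    ∫ U, wilsonLoopObs (normalisedCharacter 2 ∘ suRep 2)
        (rectWalk (0 : Literature.Probability.LatticeModels.Site 3) 0 j 2 2) U ∂μ ≤ 975007186 / 10 ^ 10 :=
  wilsonLoop_integral_limit_le_of_window_bound_minor (N := 2) (D := 3) (t := 1) (m := 2) (s := 1)
    (by norm_num) (by norm_num) hW hmono heven hμ hj
    (w1x3_integral_limit_le_of_windows_b1 hU hW hmono heven hμ hj) (by norm_num) (by norm_num)

end WilsonLoopLimit

end Summit.QuantumFields.GaugeBoot

end
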